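import Mathlib.MeasureTheory.Measure.Lebesgue.VolumeOfBalls
import Mathlib.MeasureTheory.Integral.Prod
import Mathlib.Analysis.InnerProductSpace.Projection.Reflection
import Mathlib.MeasureTheory.Integral.IntervalIntegral.FundThmCalculus
import Mathlib.Analysis.SpecialFunctions.Integrals.Basic
import Mathlib.Analysis.SpecialFunctions.Trigonometric.DerivHyp
import Literature.Algebra.EuclideanLattices.RegevBallGeometry
import HarnessLib

/-!
# Archimedes' projection theorem: plane-wave slices of balls in `ℝ³`

Analysis/Calculus support file (everything PROVED; no definitions, no named facts).

For a continuous profile `g : ℝ → F` and a unit vector `e ∈ ℝ³`, the integral over a ball of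
the **plane wave** `y ↦ g ⟪y, e⟫` reduces to one dimension («Cavalieri for the ball»: the section
of `B_r` by the plane `⟪y, e⟫ = t` is a disc of area `π (r² − t²)`):

* `integral_ball_comp_apply_zero`, `integral_ball_comp_inner` —
  `∫_{B_r} g ⟪y, e⟫ dy = ∫_{−r}^{r} π (r² − t²) · g(t) dt` (`0 ≤ r`);
* `hasDerivAt_intervalIntegral_discWeight` / `hasDerivAt_integral_ball_comp_inner` — its
  `r`-derivative `2πr ∫_{−r}^{r} g` (Archimedes' «hat-box» theorem in differentiated form: the
  derivative is the integral of the plane wave over the sphere of radius `r`, and the projection of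
  the surface measure of `S²_r` to a diameter is `2πr ×` Lebesgue measure on `[−r, r]`);
* instances: `integral_ball_inner_sq_fin_three` (`∫_{B_r} ⟪y, v⟫² = (4π/15) r⁵ ‖v‖²`, the explicit
  `ℝ³` constant of `Literature.Analysis.FluidPDE.setAverage_ball_inner_sq`), `intervalIntegral_sinh_sq`
  and `hasDerivAt_integral_ball_sinh_sq_inner` (the `sinh²` plane wave = the imaginary part of a single
  complexified Fourier mode: `d/dr ∫_{B_r} sinh² ⟪y, κ⟫ dy = 2πr (sinh(2‖κ‖r)/(2‖κ‖) − r)`).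

Method: Fubini along the first axis through `Literature.Algebra.EuclideanLattices.Regev2004.splitFirst`
(`ℝ³ ≃ᵐ ℝ × ℝ²`, volume preserving) and `EuclideanSpace.volume_ball_fin_two`; a general direction is
moved to the first axis by the reflection `Submodule.reflection (ℝ ∙ (e − e₀))ᗮ` (Mathlib
`Submodule.reflection_sub`), a volume-preserving linear isometry fixing the ball; the radial derivative
is the fundamental theorem of calculus on the two moment functions `∫_{−r}^{r} g`, `∫_{−r}^{r} t² g`.

What is NOT here: the same statement phrased with `Literature.Analysis.FluidPDE.sphereIntegral`
(`sphereIntegral volume (g ∘ ⟪·, e⟫) r = 2π ∫_{−1}^{1} g (r s) ds`, obtainable from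
`hasDerivAt_integral_ball_comp_inner` and the shell formula); dimensions other than `3` (the general
statement is the Funk–Hecke formula with weight `(1 − t²)^{(d−3)/2}`); non-continuous profiles.

## References

* H. Groemer, *Geometric Applications of Fourier Series and Spherical Harmonics*, CUP 1996, §1.3,
  Lemma 1.3.1, eq. (1.3.1) (zonal integration on `S^{d−1}`:
  `∫ Φ(u·p) dσ(u) = σ_{d−1} ∫_{−1}^{1} Φ(ζ)(1 − ζ²)^{(d−3)/2} dζ`). [Groemer1996]
* Archimedes, *On the Sphere and Cylinder* I, Props. 42–43 (the «hat-box» theorem); G. B. Folland,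
  *Real Analysis*, 2nd ed. (1999), §2.7 (polar coordinates). [folklore] / [Folland1999]
-/

noncomputable section

open MeasureTheory MeasureTheory.Measure Set Function Filter Metric Module Real
open scoped InnerProductSpace RealInnerProductSpace ENNReal NNReal Topology
open Literature.Algebra.EuclideanLattices.Regev2004

namespace Literature.Analysis.Calculus

variable {F : Type*} [NormedAddCommGroup F] [NormedSpace ℝ F] [CompleteSpace F]

/-! ## Sections of the ball of `ℝ³` by the planes `y₀ = t` -/

/-- `‖splitFirst⁻¹ (t, z)‖² = t² + ∑ z_j²`. [folklore] -/
private theorem norm_sq_splitFirst_symm (t : ℝ) (z : Fin 2 → ℝ) :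
    ‖(splitFirst 2).symm (t, z)‖ ^ 2 = t ^ 2 + ∑ j : Fin 2, (z j) ^ 2 := by
  rw [norm_sq_eq_succ 2 ((splitFirst 2).symm (t, z)), splitFirst_symm_apply_zero]
  simp only [splitFirst_symm_apply_succ]

/-- The section `{z | splitFirst⁻¹ (t, z) ∈ B_r}` of the ball of `ℝ³` at height `t`: for
`t² < r²` it is (the coordinate image of) the disc of radius `√(r² − t²)`. [folklore] -/
private theorem section_ball_eq_of_sq_lt {r t : ℝ} (hr0 : 0 ≤ r) (h : t ^ 2 < r ^ 2) :
    {z : Fin 2 → ℝ | (splitFirst 2).symm (t, z) ∈ ball (0 : EuclideanSpace ℝ (Fin 3)) r} =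
      (WithLp.toLp 2) ⁻¹' ball (0 : EuclideanSpace ℝ (Fin 2)) (Real.sqrt (r ^ 2 - t ^ 2)) := by
  have hr : 0 < r := by
    rcases lt_or_eq_of_le hr0 with hr | hr
    · exact hr
    · subst hr; nlinarith [sq_nonneg t]
  ext z
  simp only [mem_setOf_eq, mem_ball_zero_iff, mem_preimage]
  have h1 := norm_sq_splitFirst_symm t z
  have h2 := norm_sq_eq_sum 2 (WithLp.toLp 2 z)
  have hz : ∑ j : Fin 2, (WithLp.toLp 2 z : EuclideanSpace ℝ (Fin 2)) j ^ 2 = ∑ j : Fin 2, (z j) ^ 2 := by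
    rfl
  rw [hz] at h2
  have hs : 0 ≤ Real.sqrt (r ^ 2 - t ^ 2) := Real.sqrt_nonneg _
  have hs2 : Real.sqrt (r ^ 2 - t ^ 2) ^ 2 = r ^ 2 - t ^ 2 := Real.sq_sqrt (by linarith)
  constructor
  · intro hlt
    have hn : 0 ≤ ‖(splitFirst 2).symm (t, z)‖ := norm_nonneg _
    have : ‖(WithLp.toLp 2 z : EuclideanSpace ℝ (Fin 2))‖ ^ 2 < Real.sqrt (r ^ 2 - t ^ 2) ^ 2 := by
      rw [hs2]; nlinarith
    exact lt_of_pow_lt_pow_left₀ 2 hs this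
  · intro hlt
    have hn : 0 ≤ ‖(WithLp.toLp 2 z : EuclideanSpace ℝ (Fin 2))‖ := norm_nonneg _
    have : ‖(splitFirst 2).symm (t, z)‖ ^ 2 < r ^ 2 := by nlinarith
    exact lt_of_pow_lt_pow_left₀ 2 hr.le this

/-- For `r² ≤ t²` the section of the ball at height `t` is empty. [folklore] -/
private theorem section_ball_eq_empty_of_le {r t : ℝ} (h : r ^ 2 ≤ t ^ 2) :
    {z : Fin 2 → ℝ | (splitFirst 2).symm (t, z) ∈ ball (0 : EuclideanSpace ℝ (Fin 3)) r} = ∅ := by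
  ext z
  simp only [mem_setOf_eq, mem_ball_zero_iff, mem_empty_iff_false, iff_false, not_lt]
  have h1 := norm_sq_splitFirst_symm t z
  have hsum : 0 ≤ ∑ j : Fin 2, (z j) ^ 2 := Finset.sum_nonneg fun _ _ => sq_nonneg _
  by_contra hlt
  rw [not_le] at hlt
  have hn : 0 ≤ ‖(splitFirst 2).symm (t, z)‖ := norm_nonneg _
  have hr : 0 < r := hn.trans_lt hlt
  have : ‖(splitFirst 2).symm (t, z)‖ ^ 2 < r ^ 2 := by nlinarith
  linarith

/-- **Area of the sections**: the section of `B_r ⊆ ℝ³` at height `t` has (real) area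
`π (r² − t²)` if `t² < r²` and `0` otherwise. [folklore] -/
private theorem volumeReal_section_ball {r : ℝ} (hr : 0 ≤ r) (t : ℝ) :
    volume.real {z : Fin 2 → ℝ | (splitFirst 2).symm (t, z) ∈ ball (0 : EuclideanSpace ℝ (Fin 3)) r} =
      if t ^ 2 < r ^ 2 then π * (r ^ 2 - t ^ 2) else 0 := by
  split_ifs with h
  · rw [section_ball_eq_of_sq_lt hr h, measureReal_def, volume_toLp_preimage_ball,
      EuclideanSpace.volume_ball_fin_two, ENNReal.toReal_mul, ENNReal.toReal_pow,
      ENNReal.toReal_ofReal (Real.sqrt_nonneg _), ENNReal.toReal_ofReal pi_pos.le,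
      Real.sq_sqrt (by linarith), mul_comm]
  · rw [section_ball_eq_empty_of_le (not_lt.mp h), measureReal_def, measure_empty, ENNReal.toReal_zero]

/-- The sections are measurable. [folklore] -/
private theorem measurableSet_section_ball (r t : ℝ) :
    MeasurableSet {z : Fin 2 → ℝ | (splitFirst 2).symm (t, z) ∈ ball (0 : EuclideanSpace ℝ (Fin 3)) r} :=
  measurableSet_ball.preimage (((splitFirst 2).symm.measurable).comp (by fun_prop))

/-! ## Cavalieri: plane-wave integrals over the ball -/

/-- **Slicing the ball of `ℝ³` along the first axis.** For a continuous profile `g` and `0 ≤ r`,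
`∫_{B_r} g(y₀) dy = ∫_{−r}^{r} π (r² − t²) · g(t) dt` — the integrated (ball) form of the zonal
integration formula `∫_{S²} Φ(u·p) dσ(u) = 2π ∫_{−1}^{1} Φ(ζ) dζ` (Groemer, Lemma 1.3.1 (1.3.1) at
`d = 3`, where `σ₂ = 2π` and the weight `(1 − ζ²)^{(d−3)/2}` is `1`). [cite: Groemer1996, Lemma 1.3.1 (1.3.1)] -/
theorem integral_ball_comp_apply_zero {g : ℝ → F} (hg : Continuous g) {r : ℝ} (hr : 0 ≤ r) :
    ∫ y in ball (0 : EuclideanSpace ℝ (Fin 3)) r, g (y 0) =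
      ∫ t in (-r)..r, (π * (r ^ 2 - t ^ 2)) • g t := by
  set B := ball (0 : EuclideanSpace ℝ (Fin 3)) r with hB
  set G : EuclideanSpace ℝ (Fin 3) → F := fun y => g (y 0) with hG
  have hGc : Continuous G := hg.comp (by fun_prop)
  -- integrability of the indicator and transfer to the product space
  have hGi : Integrable (B.indicator G) volume :=
    (integrable_indicator_iff measurableSet_ball).mpr
      ((hGc.continuousOn.integrableOn_compact (isCompact_closedBall 0 r)).mono_set ball_subset_closedBall)
  have hmp := (measurePreserving_splitFirst 2).symm (splitFirst 2)
  set H : ℝ × (Fin 2 → ℝ) → F := fun p => B.indicator G ((splitFirst 2).symm p) with hH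
  have hHi : Integrable H ((volume : Measure ℝ).prod volume) := by
    have := (hmp.integrable_comp_emb (splitFirst 2).symm.measurableEmbedding).mpr hGi
    exact this
  -- Step 1: pull back to `ℝ × ℝ²`
  have h1 : ∫ y in B, G y = ∫ p, H p ∂((volume : Measure ℝ).prod volume) := by
    rw [← integral_indicator measurableSet_ball]
    exact (hmp.integral_comp' (B.indicator G)).symm
  -- Step 2: Fubini
  have h2 : ∫ p, H p ∂((volume : Measure ℝ).prod volume) = ∫ t, ∫ z, H (t, z) := integral_prod H hHi
  -- Step 3: the inner integrals
  have h3 : ∀ t : ℝ, ∫ z, H (t, z) = (Ioo (-r) r).indicator (fun t => (π * (r ^ 2 - t ^ 2)) • g t) t := by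
    intro t
    set S := {z : Fin 2 → ℝ | (splitFirst 2).symm (t, z) ∈ B} with hS
    have hHt : (fun z => H (t, z)) = S.indicator fun _ => g t := by
      funext z
      by_cases hz : (splitFirst 2).symm (t, z) ∈ B
      · rw [indicator_of_mem (show z ∈ S from hz), hH]
        simp only [indicator_of_mem hz, hG, splitFirst_symm_apply_zero]
      · rw [indicator_of_notMem (show z ∉ S from hz), hH]
        simp only [indicator_of_notMem hz]
    rw [hHt, integral_indicator_const (g t) (measurableSet_section_ball r t),
      volumeReal_section_ball hr]
    by_cases ht : t ∈ Ioo (-r) r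
    · have : t ^ 2 < r ^ 2 := by
        rcases ht with ⟨h₁, h₂⟩
        nlinarith
      rw [if_pos this, indicator_of_mem ht]
    · have : ¬ t ^ 2 < r ^ 2 := by
        intro hlt
        apply ht
        constructor <;> nlinarith [sq_nonneg (t + r), sq_nonneg (t - r)]
      rw [if_neg this, indicator_of_notMem ht, zero_smul]
  rw [h1, h2]
  simp_rw [h3]
  rw [integral_indicator measurableSet_Ioo, intervalIntegral.integral_of_le (by linarith : -r ≤ r),
    integral_Ioc_eq_integral_Ioo]

/-- **Slicing the ball of `ℝ³` in an arbitrary direction.** For a unit vector `e`, a continuous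
profile `g` and `0 ≤ r`, `∫_{B_r} g ⟪y, e⟫ dy = ∫_{−r}^{r} π (r² − t²) · g(t) dt`: the plane-wave
integral depends on the direction only through `‖e‖ = 1` (the reflection exchanging `e` and `e₀`
is a volume-preserving isometry of the ball; Groemer's (1.3.1) for an arbitrary pole `p`, integrated
over the radius). [cite: Groemer1996, Lemma 1.3.1 (1.3.1)] -/
theorem integral_ball_comp_inner {g : ℝ → F} (hg : Continuous g) {e : EuclideanSpace ℝ (Fin 3)}
    (he : ‖e‖ = 1) {r : ℝ} (hr : 0 ≤ r) :
    ∫ y in ball (0 : EuclideanSpace ℝ (Fin 3)) r, g ⟪y, e⟫ =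
      ∫ t in (-r)..r, (π * (r ^ 2 - t ^ 2)) • g t := by
  set e₀ : EuclideanSpace ℝ (Fin 3) := EuclideanSpace.single 0 (1 : ℝ) with he₀_def
  have he₀ : ‖e₀‖ = 1 := by simp [he₀_def]
  set R : EuclideanSpace ℝ (Fin 3) ≃ₗᵢ[ℝ] EuclideanSpace ℝ (Fin 3) :=
    Submodule.reflection (ℝ ∙ (e - e₀))ᗮ with hR
  have hRe : R e = e₀ := Submodule.reflection_sub (by rw [he, he₀])
  have hinner : ∀ y : EuclideanSpace ℝ (Fin 3), ⟪y, e⟫ = (R y) 0 := by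
    intro y
    rw [← R.inner_map_map y e, hRe, he₀_def, EuclideanSpace.inner_single_right]
    simp
  have hmp : MeasurePreserving R volume volume := R.measurePreserving
  have hpre : R ⁻¹' ball (0 : EuclideanSpace ℝ (Fin 3)) r = ball 0 r := by
    rw [R.preimage_ball, map_zero]
  calc ∫ y in ball (0 : EuclideanSpace ℝ (Fin 3)) r, g ⟪y, e⟫
      = ∫ y in R ⁻¹' ball (0 : EuclideanSpace ℝ (Fin 3)) r, (fun x : EuclideanSpace ℝ (Fin 3) => g (x 0)) (R y) := by
        rw [hpre]
        refine setIntegral_congr_fun measurableSet_ball fun y _ => ?_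
        simp only [hinner y]
    _ = ∫ x in ball (0 : EuclideanSpace ℝ (Fin 3)) r, g (x 0) :=
        hmp.setIntegral_preimage_emb R.toHomeomorph.measurableEmbedding
          (fun x : EuclideanSpace ℝ (Fin 3) => g (x 0)) (ball (0 : EuclideanSpace ℝ (Fin 3)) r)
    _ = ∫ t in (-r)..r, (π * (r ^ 2 - t ^ 2)) • g t := integral_ball_comp_apply_zero hg hr

/-! ## The radial derivative of the plane-wave integral -/

/-- **Derivative of the disc-weighted integral.** For continuous `g`,
`d/dr ∫_{−r}^{r} π (r² − t²) g(t) dt = 2πr ∫_{−r}^{r} g(t) dt` (the boundary terms vanish because the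
weight `π (r² − t²)` vanishes at `t = ±r`). [folklore] -/
private theorem hasDerivAt_intervalIntegral_discWeight {g : ℝ → F} (hg : Continuous g) (r : ℝ) :
    HasDerivAt (fun ρ : ℝ => ∫ t in (-ρ)..ρ, (π * (ρ ^ 2 - t ^ 2)) • g t)
      ((2 * π * r) • ∫ t in (-r)..r, g t) r := by
  -- the two moment functions `Φ₀(ρ) = ∫_{-ρ}^{ρ} g`, `Φ₂(ρ) = ∫_{-ρ}^{ρ} t² g`
  have hg2 : Continuous fun t : ℝ => t ^ 2 • g t := (continuous_id.pow 2).smul hg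
  have hsplit : ∀ ρ : ℝ, ∫ t in (-ρ)..ρ, (π * (ρ ^ 2 - t ^ 2)) • g t =
      (π * ρ ^ 2) • (∫ t in (-ρ)..ρ, g t) - π • ∫ t in (-ρ)..ρ, t ^ 2 • g t := by
    intro ρ
    have h1 : ∀ t, (π * (ρ ^ 2 - t ^ 2)) • g t = (π * ρ ^ 2) • g t - π • (t ^ 2 • g t) := by
      intro t
      rw [smul_smul, ← sub_smul]
      ring_nf
    simp_rw [h1]
    have i1 : IntervalIntegrable (fun t : ℝ => (π * ρ ^ 2) • g t) volume (-ρ) ρ :=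
      (hg.const_smul (π * ρ ^ 2)).intervalIntegrable _ _
    have i2 : IntervalIntegrable (fun t : ℝ => π • (t ^ 2 • g t)) volume (-ρ) ρ :=
      (hg2.const_smul π).intervalIntegrable _ _
    rw [intervalIntegral.integral_sub i1 i2, intervalIntegral.integral_smul,
      intervalIntegral.integral_smul]
  -- derivatives of `ρ ↦ ∫_{0}^{ρ} h` and `ρ ↦ ∫_{0}^{-ρ} h`
  have hFTC : ∀ {h : ℝ → F}, Continuous h →
      HasDerivAt (fun ρ : ℝ => ∫ t in (-ρ)..ρ, h t) (h r + h (-r)) r := by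
    intro h hh
    have hsub : ∀ ρ : ℝ, ∫ t in (-ρ)..ρ, h t = (∫ t in (0:ℝ)..ρ, h t) - ∫ t in (0:ℝ)..(-ρ), h t := by
      intro ρ
      rw [intervalIntegral.integral_interval_sub_left (hh.intervalIntegrable _ _)
        (hh.intervalIntegrable _ _)]
    have hA : HasDerivAt (fun ρ : ℝ => ∫ t in (0:ℝ)..ρ, h t) (h r) r :=
      (hh.integral_hasStrictDerivAt 0 r).hasDerivAt
    have hB : HasDerivAt (fun ρ : ℝ => ∫ t in (0:ℝ)..(-ρ), h t) ((-1 : ℝ) • h (-r)) r := by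
      have h1 : HasDerivAt (fun s : ℝ => ∫ t in (0:ℝ)..s, h t) (h (-r)) (-r) :=
        (hh.integral_hasStrictDerivAt 0 (-r)).hasDerivAt
      exact h1.scomp r (hasDerivAt_neg r)
    have := hA.sub hB
    simp only [neg_smul, one_smul, sub_neg_eq_add] at this
    refine this.congr_of_eventuallyEq (Eventually.of_forall fun ρ => hsub ρ)
  have hΦ₀ := hFTC hg
  have hΦ₂ := hFTC hg2
  -- the product `(π ρ²) • Φ₀ ρ`
  have hc : HasDerivAt (fun ρ : ℝ => π * ρ ^ 2) (π * (2 * r)) r := by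
    simpa using (hasDerivAt_pow 2 r).const_mul π
  have hprod := hc.fun_smul hΦ₀
  have hall := hprod.fun_sub (hΦ₂.fun_const_smul π)
  have hfun : (fun ρ : ℝ => ∫ t in (-ρ)..ρ, (π * (ρ ^ 2 - t ^ 2)) • g t) =
      fun ρ => (π * ρ ^ 2) • (∫ t in (-ρ)..ρ, g t) - π • ∫ t in (-ρ)..ρ, t ^ 2 • g t := by
    funext ρ; exact hsplit ρ
  rw [hfun]
  refine hall.congr_deriv ?_
  simp only [neg_pow_two] 
  module

/-- **Radial derivative of the plane-wave integral over the ball**: for `r > 0`,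
`d/dr ∫_{B_r} g ⟪y, e⟫ dy = 2πr ∫_{−r}^{r} g(t) dt`
(= `r² ∫_{S²} g(r u·e) dσ(u) = r² · 2π ∫_{−1}^{1} g(rζ) dζ`, Groemer's zonal formula (1.3.1) at `d = 3`
on the sphere of radius `r`; Archimedes' hat-box theorem). [cite: Groemer1996, Lemma 1.3.1 (1.3.1)] -/
theorem hasDerivAt_integral_ball_comp_inner {g : ℝ → F} (hg : Continuous g)
    {e : EuclideanSpace ℝ (Fin 3)} (he : ‖e‖ = 1) {r : ℝ} (hr : 0 < r) :
    HasDerivAt (fun ρ : ℝ => ∫ y in ball (0 : EuclideanSpace ℝ (Fin 3)) ρ, g ⟪y, e⟫)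
      ((2 * π * r) • ∫ t in (-r)..r, g t) r := by
  refine (hasDerivAt_intervalIntegral_discWeight hg r).congr_of_eventuallyEq ?_
  filter_upwards [Ioi_mem_nhds hr] with ρ hρ
  exact integral_ball_comp_inner hg he (le_of_lt hρ)

/-! ## Instances: second moment and the `sinh²` plane wave -/

/-- **Second moment of the ball of `ℝ³` in a direction**: `∫_{B_r} ⟪y, v⟫² dy = (4π/15) r⁵ ‖v‖²`
(`0 ≤ r`). The general-dimension averaged form is
`Literature.Analysis.FluidPDE.setAverage_ball_inner_sq`; this is the explicit `ℝ³` constant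
(e.g. the `r⁵`-jet coefficient `∫_{B_r} y_j y_l dy = (4π/15) r⁵ δ_{jl}`). [cite: Folland1999, Exercise 2.63] -/
theorem integral_ball_inner_sq_fin_three (v : EuclideanSpace ℝ (Fin 3)) {r : ℝ} (hr : 0 ≤ r) :
    ∫ y in ball (0 : EuclideanSpace ℝ (Fin 3)) r, ⟪y, v⟫ ^ 2 = 4 * π / 15 * r ^ 5 * ‖v‖ ^ 2 := by
  by_cases hv : v = 0
  · subst hv; simp
  · set e : EuclideanSpace ℝ (Fin 3) := ‖v‖⁻¹ • v with he_def
    have hvn : 0 < ‖v‖ := norm_pos_iff.mpr hv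
    have he : ‖e‖ = 1 := by
      rw [he_def, norm_smul, norm_inv, norm_norm, inv_mul_cancel₀ hvn.ne']
    have hve : v = ‖v‖ • e := by
      rw [he_def, smul_smul, mul_inv_cancel₀ hvn.ne', one_smul]
    have hfun : (fun y : EuclideanSpace ℝ (Fin 3) => ⟪y, v⟫ ^ 2) =
        fun y => (fun t : ℝ => (‖v‖ * t) ^ 2) ⟪y, e⟫ := by
      funext y
      rw [hve, inner_smul_right]
      simp only
      rw [← hve]
    rw [hfun, integral_ball_comp_inner (g := fun t : ℝ => (‖v‖ * t) ^ 2) (by fun_prop) he hr]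
    simp only [smul_eq_mul]
    have : ∀ t : ℝ, π * (r ^ 2 - t ^ 2) * (‖v‖ * t) ^ 2 =
        (π * ‖v‖ ^ 2 * r ^ 2) * t ^ 2 - (π * ‖v‖ ^ 2) * t ^ 4 := fun t => by ring
    simp_rw [this]
    have i1 : IntervalIntegrable (fun t : ℝ => (π * ‖v‖ ^ 2 * r ^ 2) * t ^ 2) volume (-r) r :=
      (by fun_prop : Continuous fun t : ℝ => (π * ‖v‖ ^ 2 * r ^ 2) * t ^ 2).intervalIntegrable _ _
    have i2 : IntervalIntegrable (fun t : ℝ => (π * ‖v‖ ^ 2) * t ^ 4) volume (-r) r :=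
      (by fun_prop : Continuous fun t : ℝ => (π * ‖v‖ ^ 2) * t ^ 4).intervalIntegrable _ _
    rw [intervalIntegral.integral_sub i1 i2, intervalIntegral.integral_const_mul,
      intervalIntegral.integral_const_mul, integral_pow, integral_pow]
    ring

/-- `∫_{−r}^{r} sinh²(a t) dt = sinh(2ar)/(2a) − r` for `a ≠ 0`. [folklore] -/
private theorem intervalIntegral_sinh_sq {a : ℝ} (ha : a ≠ 0) (r : ℝ) :
    ∫ t in (-r)..r, Real.sinh (a * t) ^ 2 = Real.sinh (2 * a * r) / (2 * a) - r := by
  have hderiv : ∀ t : ℝ, HasDerivAt (fun t : ℝ => Real.sinh (2 * a * t) / (4 * a) - t / 2)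
      (Real.sinh (a * t) ^ 2) t := by
    intro t
    have h1 : HasDerivAt (fun t : ℝ => Real.sinh (2 * a * t)) (Real.cosh (2 * a * t) * (2 * a)) t := by
      have h0 : HasDerivAt (fun y : ℝ => 2 * a * y) (2 * a) t := by
        simpa using (hasDerivAt_id t).const_mul (2 * a)
      exact (Real.hasDerivAt_sinh (2 * a * t)).comp t h0
    have h2 : HasDerivAt (fun t : ℝ => Real.sinh (2 * a * t) / (4 * a) - t / 2)
        (Real.cosh (2 * a * t) * (2 * a) / (4 * a) - 1 / 2) t :=
      (h1.div_const (4 * a)).fun_sub ((hasDerivAt_id t).div_const 2)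
    refine h2.congr_deriv ?_
    rw [show 2 * a * t = 2 * (a * t) by ring, Real.cosh_two_mul, Real.cosh_sq]
    field_simp
    ring
  rw [intervalIntegral.integral_eq_sub_of_hasDerivAt (fun t _ => hderiv t)
      ((by fun_prop : Continuous fun t : ℝ => Real.sinh (a * t) ^ 2).intervalIntegrable _ _)]
  rw [show 2 * a * -r = -(2 * a * r) by ring, Real.sinh_neg]
  field_simp
  ring

/-- **The `sinh²` plane wave over the ball** (the imaginary part of a single complexified Fourier
mode `sin ⟪κ, x + iy⟫`): for `κ ≠ 0` and `r > 0`,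
`d/dr ∫_{B_r} sinh² ⟪y, κ⟫ dy = 2πr (sinh(2‖κ‖r)/(2‖κ‖) − r) = 2πr² (sinh(2‖κ‖r)/(2‖κ‖r) − 1)`
(Groemer's (1.3.1) at `d = 3` with `Φ = sinh²(‖κ‖ ·)` on the sphere of radius `r`).
[cite: Groemer1996, Lemma 1.3.1 (1.3.1)] -/
theorem hasDerivAt_integral_ball_sinh_sq_inner {κ : EuclideanSpace ℝ (Fin 3)} (hκ : κ ≠ 0)
    {r : ℝ} (hr : 0 < r) :
    HasDerivAt (fun ρ : ℝ => ∫ y in ball (0 : EuclideanSpace ℝ (Fin 3)) ρ, Real.sinh ⟪y, κ⟫ ^ 2)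
      (2 * π * r * (Real.sinh (2 * ‖κ‖ * r) / (2 * ‖κ‖) - r)) r := by
  set e : EuclideanSpace ℝ (Fin 3) := ‖κ‖⁻¹ • κ with he_def
  have hκn : 0 < ‖κ‖ := norm_pos_iff.mpr hκ
  have he : ‖e‖ = 1 := by
    rw [he_def, norm_smul, norm_inv, norm_norm, inv_mul_cancel₀ hκn.ne']
  have hκe : κ = ‖κ‖ • e := by
    rw [he_def, smul_smul, mul_inv_cancel₀ hκn.ne', one_smul]
  have hfun : (fun ρ : ℝ => ∫ y in ball (0 : EuclideanSpace ℝ (Fin 3)) ρ, Real.sinh ⟪y, κ⟫ ^ 2) =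
      fun ρ => ∫ y in ball (0 : EuclideanSpace ℝ (Fin 3)) ρ,
        (fun t : ℝ => Real.sinh (‖κ‖ * t) ^ 2) ⟪y, e⟫ := by
    funext ρ
    refine setIntegral_congr_fun measurableSet_ball fun y _ => ?_
    simp only
    rw [hκe, inner_smul_right, ← hκe]
  rw [hfun]
  have h := hasDerivAt_integral_ball_comp_inner
    (g := fun t : ℝ => Real.sinh (‖κ‖ * t) ^ 2) (by fun_prop) he hr
  rw [intervalIntegral_sinh_sq hκn.ne', smul_eq_mul] at h
  exact h

end Literature.Analysis.Calculus
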